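import Literature.Probability.LatticeModels.TorusGreenHeatKernel
import HarnessLib

/-!
# Decay of the Hessian of the torus Green function in four dimensions

Topic `Probability/LatticeModels`, conclusion of the chain `SRWHeatKernel1D` → `SRWHeatKernelDifferences`
→ `TorusHeatKernel1D` → `TorusGreenHeatKernel`. For the zero-mode-removed Green function
`G̃_L = torusGreen` of the discrete torus `(ℤ/Lℤ)⁴` (`LatticeGreenFunction.lean`:
`torusGreen z = L⁻⁴ ∑_{k ≠ 0} cos(p_k·z)/ε(p_k)`, twice the Green function of `-Δ` with the constant
mode removed) we PROVE the discrete Calderón–Zygmund estimate, UNIFORM IN THE PERIOD `L`: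

* `torusGreen_hessian_mul_dist_pow_four_le` — there is an absolute constant `C` such that for all
  `L ≥ 1`, all directions `i, j` and all `z ≠ 0` in `(ℤ/Lℤ)⁴`,
  `|∇ᵢ⁺∇ⱼ⁻ G̃_L(z)| · dist(0, z)⁴ ≤ C`, where
  `∇ᵢ⁺∇ⱼ⁻G(z) = G(z+eᵢ) - G(z+eᵢ-eⱼ) - G(z) + G(z-eⱼ)` and `dist(0,z)² = ∑_μ z̃_μ²` is the squared
  Euclidean torus distance in centred coordinates `z̃_μ = valMinAbs (z μ) ∈ (-L/2, L/2]`.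

This is the lattice (and finite-volume) counterpart of `∂ᵢ∂ⱼ |x|^{-2} = O(|x|^{-4})` for the
Newtonian potential of `ℝ⁴`; at `dist ≍ L` it says `|∇∇G̃_L| ≤ C L⁻⁴`, the size of the Hessian of the
quadratic background `-|z|²/(8L⁴)·(const)` produced by the removed zero mode.

Proof (heat kernel, `TorusGreenHeatKernel.lean`): `∇∇G̃_L(z) = ∫₀^{L²} ∇∇[∏_μ q^L_s(z_μ)] ds + tail`,
`|tail| ≤ C L⁻⁴`; the Hessian of the product kernel is a product of one-dimensional differences
(`(q^L_s(zᵢ+1) - q^L_s(zᵢ))(q^L_s(zⱼ) - q^L_s(zⱼ-1)) ∏_{μ ≠ i,j} q^L_s(z_μ)` for `i ≠ j`, a second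
difference times `∏_{μ ≠ i} q^L_s` for `i = j`), each factor bounded by `TorusHeatKernel1D.lean`:
altogether `≤ K⁴ (1∨s)⁻³ (1 + M²/(1∨s))⁻³ ≤ K⁴ (s + M²)⁻³` with `M = max_μ |z̃_μ| ≥ 1`, whose time
integral is `≤ K⁴/(2M⁴)`; finally `dist² ≤ 4M²` and `L ≥ 2M`.

## References

* G. F. Lawler, V. Limic, *Random Walk: A Modern Introduction*, CUP 2010, Ch. 4 (Green's
  functions through the heat kernel / LCLT; Thm. 4.3.1 for the `|x|^{2-d}` asymptotics with
  `O(|x|^{-d})` error on `ℤ^d`) and §6.3 (difference estimates) [LawlerLimic2010]; the torus version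
  with the zero mode removed, uniform in the period, is folklore in lattice field theory.
-/

noncomputable section

open MeasureTheory Set Filter Finset ZMod intervalIntegral
open scoped Real Topology BigOperators ComplexConjugate

namespace Literature.Probability.LatticeModels

variable {d L : ℕ} [NeZero L]

/-! ### The Hessian of a product kernel -/

omit [NeZero L] in
/-- Splitting a product over `Fin d` at two distinct indices. [folklore] -/
private theorem prod_eq_mul_mul_prod_erase_erase {i j : Fin d} (hij : i ≠ j) (f : Fin d → ℝ) :
    ∏ μ, f μ = f i * f j * ∏ μ ∈ ((univ : Finset (Fin d)).erase i).erase j, f μ := by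
  rw [mul_assoc, Finset.mul_prod_erase _ _ (Finset.mem_erase.2 ⟨hij.symm, Finset.mem_univ j⟩),
    Finset.mul_prod_erase _ _ (Finset.mem_univ i)]

omit [NeZero L] in
/-- **The mixed second difference of a product kernel, `i ≠ j`**:
`∇ᵢ⁺∇ⱼ⁻[∏_μ q(·_μ)](z) = (q(zᵢ+1) - q(zᵢ)) (q(zⱼ) - q(zⱼ-1)) ∏_{μ ≠ i,j} q(z_μ)`. [folklore] -/
theorem hessian_prod_of_ne (q : ZMod L → ℝ) (z : TorusSite d L) {i j : Fin d} (hij : i ≠ j) :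
    (∏ μ, q ((z + Pi.single i 1 : TorusSite d L) μ)) -
        (∏ μ, q ((z + Pi.single i 1 - Pi.single j 1 : TorusSite d L) μ)) -
        (∏ μ, q (z μ)) + ∏ μ, q ((z - Pi.single j 1 : TorusSite d L) μ) =
      (q (z i + 1) - q (z i)) * (q (z j) - q (z j - 1)) *
        ∏ μ ∈ ((univ : Finset (Fin d)).erase i).erase j, q (z μ) := by
  set zA : TorusSite d L := z + Pi.single i 1 with hzA
  set zB : TorusSite d L := z + Pi.single i 1 - Pi.single j 1 with hzB
  set zD : TorusSite d L := z - Pi.single j 1 with hzD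
  have hE : ∀ μ ∈ ((univ : Finset (Fin d)).erase i).erase j, μ ≠ i ∧ μ ≠ j := fun μ hμ =>
    ⟨Finset.ne_of_mem_erase (Finset.mem_of_mem_erase hμ), Finset.ne_of_mem_erase hμ⟩
  have hAi : zA i = z i + 1 := by simp [hzA]
  have hAj : zA j = z j := by simp [hzA, Pi.single_eq_of_ne hij.symm]
  have hBi : zB i = z i + 1 := by simp [hzB, Pi.single_eq_of_ne hij]
  have hBj : zB j = z j - 1 := by simp [hzB, Pi.single_eq_of_ne hij.symm]
  have hDi : zD i = z i := by simp [hzD, Pi.single_eq_of_ne hij]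
  have hDj : zD j = z j - 1 := by simp [hzD]
  have hA : ∏ μ ∈ ((univ : Finset (Fin d)).erase i).erase j, q (zA μ) =
      ∏ μ ∈ ((univ : Finset (Fin d)).erase i).erase j, q (z μ) :=
    Finset.prod_congr rfl fun μ hμ => by
      simp [hzA, Pi.single_eq_of_ne (hE μ hμ).1]
  have hB : ∏ μ ∈ ((univ : Finset (Fin d)).erase i).erase j, q (zB μ) =
      ∏ μ ∈ ((univ : Finset (Fin d)).erase i).erase j, q (z μ) :=
    Finset.prod_congr rfl fun μ hμ => by
      simp [hzB, Pi.single_eq_of_ne (hE μ hμ).1, Pi.single_eq_of_ne (hE μ hμ).2]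
  have hD : ∏ μ ∈ ((univ : Finset (Fin d)).erase i).erase j, q (zD μ) =
      ∏ μ ∈ ((univ : Finset (Fin d)).erase i).erase j, q (z μ) :=
    Finset.prod_congr rfl fun μ hμ => by
      simp [hzD, Pi.single_eq_of_ne (hE μ hμ).2]
  rw [prod_eq_mul_mul_prod_erase_erase hij (fun μ => q (zA μ)),
    prod_eq_mul_mul_prod_erase_erase hij (fun μ => q (zB μ)),
    prod_eq_mul_mul_prod_erase_erase hij (fun μ => q (z μ)),
    prod_eq_mul_mul_prod_erase_erase hij (fun μ => q (zD μ)), hA, hB, hD, hAi, hAj, hBi, hBj,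
    hDi, hDj]
  ring

omit [NeZero L] in
/-- **The second difference of a product kernel, `i = j`**:
`∇ᵢ⁺∇ᵢ⁻[∏_μ q(·_μ)](z) = (q(zᵢ+1) - 2q(zᵢ) + q(zᵢ-1)) ∏_{μ ≠ i} q(z_μ)`. [folklore] -/
theorem hessian_prod_of_eq (q : ZMod L → ℝ) (z : TorusSite d L) (i : Fin d) :
    (∏ μ, q ((z + Pi.single i 1 : TorusSite d L) μ)) -
        (∏ μ, q ((z + Pi.single i 1 - Pi.single i 1 : TorusSite d L) μ)) -
        (∏ μ, q (z μ)) + ∏ μ, q ((z - Pi.single i 1 : TorusSite d L) μ) =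
      (q (z i + 1) - 2 * q (z i) + q (z i - 1)) * ∏ μ ∈ (univ : Finset (Fin d)).erase i, q (z μ) := by
  rw [add_sub_cancel_right]
  set zA : TorusSite d L := z + Pi.single i 1 with hzA
  set zD : TorusSite d L := z - Pi.single i 1 with hzD
  have hE : ∀ μ ∈ (univ : Finset (Fin d)).erase i, μ ≠ i := fun μ hμ => Finset.ne_of_mem_erase hμ
  have hAi : zA i = z i + 1 := by simp [hzA]
  have hDi : zD i = z i - 1 := by simp [hzD]
  have hA : ∏ μ ∈ (univ : Finset (Fin d)).erase i, q (zA μ) =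
      ∏ μ ∈ (univ : Finset (Fin d)).erase i, q (z μ) :=
    Finset.prod_congr rfl fun μ hμ => by simp [hzA, Pi.single_eq_of_ne (hE μ hμ)]
  have hD : ∏ μ ∈ (univ : Finset (Fin d)).erase i, q (zD μ) =
      ∏ μ ∈ (univ : Finset (Fin d)).erase i, q (z μ) :=
    Finset.prod_congr rfl fun μ hμ => by simp [hzD, Pi.single_eq_of_ne (hE μ hμ)]
  rw [← Finset.mul_prod_erase _ (fun μ => q (zA μ)) (Finset.mem_univ i),
    ← Finset.mul_prod_erase _ (fun μ => q (z μ)) (Finset.mem_univ i),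
    ← Finset.mul_prod_erase _ (fun μ => q (zD μ)) (Finset.mem_univ i), hA, hD, hAi, hDi]
  ring

omit [NeZero L] in
/-- A product of numbers in `[0, 1]` is at most any one of its factors. [folklore] -/
private theorem prod_le_apply_of_le_one {W : Fin d → ℝ} (h0 : ∀ μ, 0 ≤ W μ) (h1 : ∀ μ, W μ ≤ 1)
    (μ₀ : Fin d) : ∏ μ, W μ ≤ W μ₀ := by
  rw [← Finset.mul_prod_erase _ _ (Finset.mem_univ μ₀)]
  exact mul_le_of_le_one_right (h0 μ₀) (Finset.prod_le_one (fun μ _ => h0 μ) fun μ _ => h1 μ)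

/-! ### The Hessian of the product heat kernel in `d = 4` -/

/-- **Bound on the Hessian of the product heat kernel of `(ℤ/Lℤ)⁴`**: there is `K > 0` such that
for all `L ≥ 1`, `0 < s ≤ L²`, `z ∈ (ℤ/Lℤ)⁴`, all `i, j` and every coordinate `μ₀`,
`|∇ᵢ⁺∇ⱼ⁻[∏_μ q^L_s(·_μ)](z)| ≤ K ((1∨s) + z̃_{μ₀}²)⁻³` (`z̃ = valMinAbs`): the four one-dimensional
factors contribute `(1∨s)^{-1/2}` each, the two differences one more `(1∨s)^{-1/2}` each, and every
factor a Gaussian weight `(1 + z̃_μ²/(1∨s))⁻³ ≤ 1`, of which the one at `μ₀` is kept. [folklore] -/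
theorem abs_hessian_prod_torusHeatKernel_le : ∃ K : ℝ, 0 < K ∧ ∀ (L : ℕ) [NeZero L] (s : ℝ),
    0 < s → s ≤ (L : ℝ) ^ 2 → ∀ (z : TorusSite 4 L) (i j μ₀ : Fin 4),
      |(∏ μ, torusHeatKernel s ((z + Pi.single i 1 : TorusSite 4 L) μ)) -
          (∏ μ, torusHeatKernel s ((z + Pi.single i 1 - Pi.single j 1 : TorusSite 4 L) μ)) -
          (∏ μ, torusHeatKernel s (z μ)) +
          ∏ μ, torusHeatKernel s ((z - Pi.single j 1 : TorusSite 4 L) μ)| ≤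
        K * ((max 1 s + ((z μ₀).valMinAbs : ℝ) ^ 2) ^ 3)⁻¹ := by
  obtain ⟨K₀, hK₀, h₀⟩ := abs_torusHeatKernel_le
  obtain ⟨K₁, hK₁, h₁⟩ := abs_torusHeatKernel_fwdDiff_le
  obtain ⟨K₂, hK₂, h₂⟩ := abs_torusHeatKernel_bwdDiff_le
  obtain ⟨K₃, hK₃, h₃⟩ := abs_torusHeatKernel_sndDiff_le
  set K : ℝ := max (max K₀ K₁) (max K₂ K₃) with hK
  have hK0 : K₀ ≤ K := (le_max_left _ _).trans (le_max_left _ _)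
  have hK1 : K₁ ≤ K := (le_max_right _ _).trans (le_max_left _ _)
  have hK2 : K₂ ≤ K := (le_max_left _ _).trans (le_max_right _ _)
  have hK3 : K₃ ≤ K := (le_max_right _ _).trans (le_max_right _ _)
  have hKpos : 0 < K := hK₀.trans_le hK0
  refine ⟨K ^ 4, by positivity, ?_⟩
  intro L _ s hs hsL z i j μ₀
  set T : ℝ := max 1 s with hT
  have hT1 : 1 ≤ T := le_max_left _ _
  have hT0 : 0 < T := by positivity
  have hsT : s ≤ T := le_max_right _ _
  set σ : ℝ := T ^ (-(1 / 2 : ℝ)) with hσ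
  have hσ0 : 0 < σ := Real.rpow_pos_of_pos hT0 _
  have hσσ : σ * σ = T⁻¹ := max_one_rpow_neg_half_mul_self s
  -- the Gaussian weights
  set W : Fin 4 → ℝ := fun μ => ((1 + ((z μ).valMinAbs : ℝ) ^ 2 / T) ^ 3)⁻¹ with hW
  have hW0 : ∀ μ, 0 ≤ W μ := fun μ => by positivity
  have hW1 : ∀ μ, W μ ≤ 1 := fun μ => by
    rw [hW]
    exact inv_le_one_of_one_le₀ (one_le_pow₀ (by
      have : 0 ≤ ((z μ).valMinAbs : ℝ) ^ 2 / T := by positivity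
      linarith))
  have hWμ₀ : ∏ μ, W μ ≤ W μ₀ := prod_le_apply_of_le_one hW0 hW1 μ₀
  -- the one-dimensional bounds with the common constant `K`
  have b₀ : ∀ m : ZMod L, |torusHeatKernel s m| ≤
      K * σ * ((1 + (m.valMinAbs : ℝ) ^ 2 / T) ^ 3)⁻¹ := fun m =>
    (h₀ L s hs hsL m).trans (by gcongr)
  have b₁ : ∀ m : ZMod L, |torusHeatKernel s (m + 1) - torusHeatKernel s m| ≤
      K * T⁻¹ * ((1 + (m.valMinAbs : ℝ) ^ 2 / T) ^ 3)⁻¹ := fun m =>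
    (h₁ L s hs hsL m).trans (by gcongr)
  have b₂ : ∀ m : ZMod L, |torusHeatKernel s m - torusHeatKernel s (m - 1)| ≤
      K * T⁻¹ * ((1 + (m.valMinAbs : ℝ) ^ 2 / T) ^ 3)⁻¹ := fun m =>
    (h₂ L s hs hsL m).trans (by gcongr)
  have b₃ : ∀ m : ZMod L,
      |torusHeatKernel s (m + 1) - 2 * torusHeatKernel s m + torusHeatKernel s (m - 1)| ≤
      K * (T⁻¹ * σ) * ((1 + (m.valMinAbs : ℝ) ^ 2 / T) ^ 3)⁻¹ := fun m =>
    (h₃ L s hs hsL m).trans (by gcongr)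
  -- the target weight
  have htarget : K ^ 4 * T⁻¹ ^ 3 * W μ₀ = K ^ 4 * ((T + ((z μ₀).valMinAbs : ℝ) ^ 2) ^ 3)⁻¹ := by
    rw [hW]
    simp only
    have hTne : T ≠ 0 := hT0.ne'
    rw [mul_assoc, inv_pow, ← mul_inv, ← mul_pow]
    congr 3
    field_simp
  rw [← htarget]
  rcases eq_or_ne i j with rfl | hij
  · -- `i = j`: second difference times three plain factors
    rw [hessian_prod_of_eq (fun m => torusHeatKernel s m) z i, abs_mul, Finset.abs_prod]
    have hcard : ((univ : Finset (Fin 4)).erase i).card = 3 := by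
      rw [Finset.card_erase_of_mem (Finset.mem_univ i), Finset.card_univ, Fintype.card_fin]
    have hrest : ∏ μ ∈ (univ : Finset (Fin 4)).erase i, |torusHeatKernel s (z μ)| ≤
        ∏ μ ∈ (univ : Finset (Fin 4)).erase i, (K * σ * W μ) :=
      Finset.prod_le_prod (fun μ _ => abs_nonneg _) fun μ _ => b₀ (z μ)
    calc |torusHeatKernel s (z i + 1) - 2 * torusHeatKernel s (z i) + torusHeatKernel s (z i - 1)| *
          ∏ μ ∈ (univ : Finset (Fin 4)).erase i, |torusHeatKernel s (z μ)|
        ≤ (K * (T⁻¹ * σ) * W i) * ∏ μ ∈ (univ : Finset (Fin 4)).erase i, (K * σ * W μ) :=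
          mul_le_mul (b₃ (z i)) hrest (Finset.prod_nonneg fun μ _ => abs_nonneg _) (by positivity)
      _ = K ^ 4 * (T⁻¹ * (σ * σ) * (σ * σ)) * (W i * ∏ μ ∈ (univ : Finset (Fin 4)).erase i, W μ) := by
          rw [Finset.prod_mul_distrib, Finset.prod_const, hcard]
          ring
      _ = K ^ 4 * T⁻¹ ^ 3 * ∏ μ, W μ := by
          rw [hσσ, Finset.mul_prod_erase _ _ (Finset.mem_univ i)]
          ring
      _ ≤ K ^ 4 * T⁻¹ ^ 3 * W μ₀ := by gcongr
  · -- `i ≠ j`: two first differences times two plain factors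
    rw [hessian_prod_of_ne (fun m => torusHeatKernel s m) z hij, abs_mul, abs_mul, Finset.abs_prod]
    have hcard : (((univ : Finset (Fin 4)).erase i).erase j).card = 2 := by
      rw [Finset.card_erase_of_mem (Finset.mem_erase.2 ⟨hij.symm, Finset.mem_univ j⟩),
        Finset.card_erase_of_mem (Finset.mem_univ i), Finset.card_univ, Fintype.card_fin]
    have hrest : ∏ μ ∈ ((univ : Finset (Fin 4)).erase i).erase j, |torusHeatKernel s (z μ)| ≤
        ∏ μ ∈ ((univ : Finset (Fin 4)).erase i).erase j, (K * σ * W μ) :=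
      Finset.prod_le_prod (fun μ _ => abs_nonneg _) fun μ _ => b₀ (z μ)
    calc |torusHeatKernel s (z i + 1) - torusHeatKernel s (z i)| *
          |torusHeatKernel s (z j) - torusHeatKernel s (z j - 1)| *
          ∏ μ ∈ ((univ : Finset (Fin 4)).erase i).erase j, |torusHeatKernel s (z μ)|
        ≤ (K * T⁻¹ * W i) * (K * T⁻¹ * W j) *
            ∏ μ ∈ ((univ : Finset (Fin 4)).erase i).erase j, (K * σ * W μ) :=
          mul_le_mul (mul_le_mul (b₁ (z i)) (b₂ (z j)) (abs_nonneg _) (by positivity)) hrest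
            (Finset.prod_nonneg fun μ _ => abs_nonneg _) (by positivity)
      _ = K ^ 4 * (T⁻¹ * T⁻¹ * (σ * σ)) *
            (W i * W j * ∏ μ ∈ ((univ : Finset (Fin 4)).erase i).erase j, W μ) := by
          rw [Finset.prod_mul_distrib, Finset.prod_const, hcard]
          ring
      _ = K ^ 4 * T⁻¹ ^ 3 * ∏ μ, W μ := by
          rw [hσσ, ← prod_eq_mul_mul_prod_erase_erase hij W]
          ring
      _ ≤ K ^ 4 * T⁻¹ ^ 3 * W μ₀ := by gcongr

/-! ### The time integral -/

omit [NeZero L] in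
/-- `∫₀^S ((s + c)³)⁻¹ ds ≤ c⁻²/2` for `c > 0`, `S ≥ 0`. [folklore] -/
private theorem integral_inv_add_cube_le {c S : ℝ} (hc : 0 < c) (hS : 0 ≤ S) :
    ∫ s in (0 : ℝ)..S, ((s + c) ^ 3)⁻¹ ≤ (c ^ 2)⁻¹ / 2 := by
  have hzpow : ∀ u : ℝ, (u ^ 3)⁻¹ = u ^ (-3 : ℤ) := fun u => by
    rw [show (-3 : ℤ) = -((3 : ℕ) : ℤ) by norm_num, zpow_neg, zpow_natCast]
  rw [intervalIntegral.integral_comp_add_right (fun u : ℝ => (u ^ 3)⁻¹) c, zero_add]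
  simp_rw [hzpow]
  have h0 : (0 : ℝ) ∉ Set.uIcc c (S + c) := by
    rw [Set.uIcc_of_le (by linarith)]
    intro h
    exact absurd h.1 (not_le.2 hc)
  rw [integral_zpow (Or.inr ⟨by norm_num, h0⟩)]
  have e1 : (-3 : ℤ) + 1 = -((2 : ℕ) : ℤ) := by norm_num
  have h2 : (S + c) ^ ((-3 : ℤ) + 1) = ((S + c) ^ 2)⁻¹ := by rw [e1, zpow_neg, zpow_natCast]
  have h3 : c ^ ((-3 : ℤ) + 1) = (c ^ 2)⁻¹ := by rw [e1, zpow_neg, zpow_natCast]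
  rw [h2, h3]
  have hpos : 0 ≤ ((S + c) ^ 2)⁻¹ := by positivity
  norm_num
  rw [div_neg]
  linarith

/-! ### The main estimate -/

/-- **Decay of the Hessian of the torus Green function in `d = 4`, uniformly in the period.**
There is an absolute constant `C` such that for every `L ≥ 1`, all `i, j ∈ {0,1,2,3}` and every
`z ≠ 0` in `(ℤ/Lℤ)⁴`,
`|G̃_L(z+eᵢ) - G̃_L(z+eᵢ-eⱼ) - G̃_L(z) + G̃_L(z-eⱼ)| · (∑_μ z̃_μ²)² ≤ C`,
`G̃_L = torusGreen`, `z̃_μ = valMinAbs (z μ)` (so `(∑_μ z̃_μ²)^{1/2} ≤ L` is the Euclidean torus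
distance from `0` to `z`). A discrete, finite-volume Calderón–Zygmund bound: the mixed second
differences of the Green function of `(ℤ/Lℤ)⁴` decay like `dist⁻⁴`, with a constant independent of
`L` (cf. Lawler–Limic 2010, Ch. 4 and §6.3, for `ℤ^d`). [folklore] -/
theorem torusGreen_hessian_mul_dist_pow_four_le : ∃ C : ℝ, ∀ (L : ℕ) [NeZero L] (i j : Fin 4)
    (z : TorusSite 4 L), z ≠ 0 →
      |torusGreen (z + Pi.single i 1) - torusGreen (z + Pi.single i 1 - Pi.single j 1) -
          torusGreen z + torusGreen (z - Pi.single j 1)| *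
        Real.sqrt (∑ k, (((z k).valMinAbs : ℤ) : ℝ) ^ 2) ^ 4 ≤ C := by
  obtain ⟨K, hK, hP⟩ := abs_hessian_prod_torusHeatKernel_le
  set C₀ : ℝ := ∑' n : ℤ, (1 / 2 : ℝ) ^ n.natAbs with hC₀
  refine ⟨8 * K + π ^ 2 / 2 * C₀ ^ 4, ?_⟩
  intro L _ i j z hz
  have hL : (0 : ℝ) < L := by exact_mod_cast Nat.pos_of_ne_zero (NeZero.ne L)
  -- the largest centred coordinate
  obtain ⟨μ₀, -, hμ₀⟩ := Finset.exists_max_image (univ : Finset (Fin 4))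
    (fun μ => (z μ).valMinAbs.natAbs) Finset.univ_nonempty
  set M : ℝ := |((z μ₀).valMinAbs : ℝ)| with hM
  have hMμ : ∀ μ, |((z μ).valMinAbs : ℝ)| ≤ M := fun μ => by
    have h := hμ₀ μ (Finset.mem_univ μ)
    rw [hM, ← Int.cast_abs, ← Int.cast_abs, ← Int.natCast_natAbs, ← Int.natCast_natAbs]
    exact_mod_cast h
  have hM1 : 1 ≤ M := by
    obtain ⟨μ₁, hμ₁⟩ : ∃ μ, z μ ≠ 0 := by
      by_contra h
      push Not at h
      exact hz (funext h)
    have h1 : (z μ₁).valMinAbs ≠ 0 := fun h => hμ₁ ((ZMod.valMinAbs_eq_zero _).1 h)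
    have h2 : (1 : ℝ) ≤ |((z μ₁).valMinAbs : ℝ)| := by
      rw [← Int.cast_abs]
      exact_mod_cast Int.one_le_abs h1
    exact h2.trans (hMμ μ₁)
  have hM0 : 0 < M := by linarith
  have hML : 2 * M ≤ L := by
    have h := two_mul_abs_valMinAbs_le (z μ₀)
    rw [hM, ← Int.cast_abs]
    exact_mod_cast h
  -- the distance
  have hdist : Real.sqrt (∑ k, (((z k).valMinAbs : ℤ) : ℝ) ^ 2) ^ 4 ≤ 16 * M ^ 4 := by
    have hsum : ∑ k, (((z k).valMinAbs : ℤ) : ℝ) ^ 2 ≤ 4 * M ^ 2 := by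
      calc ∑ k, (((z k).valMinAbs : ℤ) : ℝ) ^ 2 ≤ ∑ _k : Fin 4, M ^ 2 :=
            Finset.sum_le_sum fun k _ => by
              rw [← sq_abs]
              exact pow_le_pow_left₀ (abs_nonneg _) (hMμ k) 2
        _ = 4 * M ^ 2 := by simp
    have h0 : 0 ≤ ∑ k, (((z k).valMinAbs : ℤ) : ℝ) ^ 2 := Finset.sum_nonneg fun k _ => sq_nonneg _
    calc Real.sqrt (∑ k, (((z k).valMinAbs : ℤ) : ℝ) ^ 2) ^ 4
        = (Real.sqrt (∑ k, (((z k).valMinAbs : ℤ) : ℝ) ^ 2) ^ 2) ^ 2 := by ring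
      _ = (∑ k, (((z k).valMinAbs : ℤ) : ℝ) ^ 2) ^ 2 := by rw [Real.sq_sqrt h0]
      _ ≤ (4 * M ^ 2) ^ 2 := pow_le_pow_left₀ h0 hsum 2
      _ = 16 * M ^ 4 := by ring
  -- the Hessian: heat-kernel part and tail at `S = L²`
  have hS : (0 : ℝ) ≤ (L : ℝ) ^ 2 := by positivity
  rw [torusGreen_hessian_eq z i j ((L : ℝ) ^ 2)]
  have hmain : |∫ s in (0 : ℝ)..(L : ℝ) ^ 2,
      ((∏ μ, torusHeatKernel s ((z + Pi.single i 1 : TorusSite 4 L) μ)) -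
        (∏ μ, torusHeatKernel s ((z + Pi.single i 1 - Pi.single j 1 : TorusSite 4 L) μ)) -
        (∏ μ, torusHeatKernel s (z μ)) +
        ∏ μ, torusHeatKernel s ((z - Pi.single j 1 : TorusSite 4 L) μ))| ≤
      K * ((M ^ 2) ^ 2)⁻¹ / 2 := by
    have hb : ∀ s ∈ Set.Ioc (0 : ℝ) ((L : ℝ) ^ 2),
        |(∏ μ, torusHeatKernel s ((z + Pi.single i 1 : TorusSite 4 L) μ)) -
          (∏ μ, torusHeatKernel s ((z + Pi.single i 1 - Pi.single j 1 : TorusSite 4 L) μ)) -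
          (∏ μ, torusHeatKernel s (z μ)) +
          ∏ μ, torusHeatKernel s ((z - Pi.single j 1 : TorusSite 4 L) μ)| ≤
        K * ((s + M ^ 2) ^ 3)⁻¹ := by
      intro s hs
      refine (hP L s hs.1 hs.2 z i j μ₀).trans ?_
      rw [hM, sq_abs]
      have hs0 : 0 < s + ((z μ₀).valMinAbs : ℝ) ^ 2 := by
        have := hs.1; positivity
      gcongr
      exact le_max_right _ _
    have hcont : IntervalIntegrable (fun s : ℝ => K * ((s + M ^ 2) ^ 3)⁻¹) volume 0 ((L : ℝ) ^ 2) := by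
      refine ContinuousOn.intervalIntegrable ?_
      rw [Set.uIcc_of_le hS]
      refine continuousOn_const.mul (ContinuousOn.inv₀
        ((continuousOn_id.add continuousOn_const).pow 3) fun s hs => ?_)
      have : 0 < s + M ^ 2 := by have := hs.1; positivity
      positivity
    calc _ ≤ ∫ s in (0 : ℝ)..(L : ℝ) ^ 2, K * ((s + M ^ 2) ^ 3)⁻¹ := by
          have h := intervalIntegral.norm_integral_le_of_norm_le hS
            (Filter.Eventually.of_forall fun s hs => (Real.norm_eq_abs _).le.trans (hb s hs)) hcont
          rwa [Real.norm_eq_abs] at h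
      _ = K * ∫ s in (0 : ℝ)..(L : ℝ) ^ 2, ((s + M ^ 2) ^ 3)⁻¹ :=
          intervalIntegral.integral_const_mul _ _
      _ ≤ K * (((M ^ 2) ^ 2)⁻¹ / 2) := by
          gcongr
          exact integral_inv_add_cube_le (by positivity) hS
      _ = _ := by ring
  have htail := abs_torusGreen_hessian_tail_le z i j
  rw [← hC₀] at htail
  have hLd : (0 : ℝ) < (L : ℝ) ^ 4 := by positivity
  have hL4 : ((L : ℝ) ^ 4)⁻¹ ≤ (16 * M ^ 4)⁻¹ := by
    apply inv_anti₀ (by positivity)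
    have : (2 * M) ^ 4 ≤ (L : ℝ) ^ 4 := pow_le_pow_left₀ (by positivity) hML 4
    nlinarith
  calc _ ≤ (K * ((M ^ 2) ^ 2)⁻¹ / 2 + π ^ 2 / 2 * C₀ ^ 4 / (L : ℝ) ^ 4) * (16 * M ^ 4) :=
        mul_le_mul ((abs_add_le _ _).trans (add_le_add hmain htail)) hdist (by positivity)
          (by positivity)
    _ ≤ (K * ((M ^ 2) ^ 2)⁻¹ / 2 + π ^ 2 / 2 * C₀ ^ 4 * (16 * M ^ 4)⁻¹) * (16 * M ^ 4) := by
        gcongr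
        rw [div_eq_mul_inv]
        gcongr
    _ = 8 * K + π ^ 2 / 2 * C₀ ^ 4 := by
        field_simp
        ring

end Literature.Probability.LatticeModels
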